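import Literature.AlgebraicGeometry.Motives.FunctionFieldCohomology
import Summits.HodgeConjecture.HodgeConjecture.Theorems.GenericDivisibilityHodgeClassesGenericallyDivisible
import Mathlib.Topology.Sheaves.Stalks
import HarnessLib

/-!
# Generic divisibility on a non-empty Zariski open = divisibility at the generic point
# (crux C2 `GenericDivisibilityBounded`, stmt-HodgeConjecture-18467, line `finite-level-bootstrap`)

Sorry-free, definition-free record of the registered sub-goal
`stub_genericallyDivisibleIffFunctionField` of the line `finite-level-bootstrap` on the crux C2 of
route `GenericDivisibility`.

For `X` an irreducible scheme over `ℂ` with generic point `η`, `z ∈ H^k(X(ℂ); ℤ)` and `m : ℕ`, the crux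
hypothesis at `m` — "there is a proper Zariski-closed `Z ⊊ X` and an integral class `y` on
`(X ∖ Z)(ℂ)` with `m • y = z|_{(X ∖ Z)(ℂ)}`" — holds iff the generic restriction
`z_η ∈ H^k(ℂ(X); ℤ) = colim_{U ≠ ∅ open} H^k(U(ℂ); ℤ)` (`Motives.functionFieldCohomology`,
`Motives.toFunctionField`; Bloch–Ogus 1974, (3.9); Colliot-Thélène–Voisin 2012, §2.1) is divisible by
`m`. Both directions are the elementary calculus of a filtered colimit of modules: a witness on a
non-empty open has a germ (`→`); a germ comes from some stage `U ∋ η`, and two sections with the same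
germ agree on a smaller open `W ∋ η`, whose closed complement is proper (`←`).

## Main result

* `stub_genericallyDivisibleIffFunctionField` — the equivalence above, verbatim the registered
  signature.

References: [BlochOgus1974ENS] (3.8)–(3.9); [ColliotTheleneVoisin2012] §2.1, Thm. 2.8 (ii). -/

set_option linter.dupNamespace false

noncomputable section

namespace Summit.HodgeConjecture.HodgeConjecture.Theorems

open CategoryTheory AlgebraicGeometry Opposite TopologicalSpace
open Literature.AlgebraicGeometry.Motives Literature.AlgebraicGeometry.HodgeTheory
  Literature.AlgebraicTopology.SingularHomology

/-- **Generic divisibility on a non-empty Zariski open is divisibility at the generic point.** For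
`X` irreducible over `ℂ`, `z ∈ H^k(X(ℂ); ℤ)` and `m : ℕ`: there are a Zariski-closed `Z ≠ X` and a class
`y ∈ H^k((X ∖ Z)(ℂ); ℤ)` with `m • y = z|_{(X ∖ Z)(ℂ)}` iff the restriction of `z` to the generic
point, `z_η ∈ H^k(ℂ(X); ℤ) = colim_{U ∋ η} H^k(U(ℂ); ℤ)` (Bloch–Ogus 1974, (3.9): "`H*(x, n) =
lim_{U ⊆ {x}⁻} H*(U, n)`" at the generic point; Colliot-Thélène–Voisin 2012, §2.1), is divisible by
`m` there. `→`: the open `X ∖ Z` is non-empty, hence contains `η`, and the germ map is additive.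
`←`: every element of the stalk is a germ of a section over some open `U ∋ η`; `m • y_U` and `z|_U`
have the same germ, so they agree on some open `W ∋ η`, `W ≤ U`, and `Z := X ∖ W` is closed and
proper. [cite: BlochOgus1974ENS, (3.9)] [cite: ColliotTheleneVoisin2012, §2.1 and Thm. 2.8 (ii)] -/
theorem stub_genericallyDivisibleIffFunctionField :
    ∀ ⦃X : SchemeOver ℂ⦄ [IrreducibleSpace X.left] (k : ℕ)
      (z : singularCohomology ℤ ℤ (ComplexPoints X) k) (m : ℕ),
      (∃ Z : Set X.left, IsClosed Z ∧ Z ≠ Set.univ ∧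
        ∃ y : singularCohomology ℤ ℤ (complexPointsCompl X Z) k,
          m • y = singularCohomology.map ℤ ℤ
            (⟨Subtype.val, continuous_subtype_val⟩ : C(complexPointsCompl X Z, ComplexPoints X)) k z) ↔
      ∃ y : functionFieldCohomology ℤ X k, m • y = toFunctionField ℤ X k z := by
  intro X _ k z m
  constructor
  · rintro ⟨Z, hZ, hne, y, hy⟩
    -- the non-empty open `U := X ∖ Z` contains the generic point
    let U : X.left.Opens := ⟨Zᶜ, hZ.isOpen_compl⟩
    have hU : genericPoint X.left ∈ U :=
      genericPoint_mem_of_nonempty (U := U) (Set.nonempty_compl.2 hne)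
    -- transport `y` from `(X ∖ Z)(ℂ)` to `U(ℂ) = (X ∖ Zᶜᶜ)(ℂ)` along `Z ⊆ Zᶜᶜ`
    have hsub : Z ⊆ ((U : Set X.left))ᶜ := fun x hx hx' ↦ hx' hx
    refine ⟨germToFunctionField ℤ X k U hU
      (singularCohomology.map ℤ ℤ (complexPointsComplInclusion hsub) k y), ?_⟩
    rw [← map_nsmul, ← map_nsmul, hy, ← germToFunctionField_restrictToOpen ℤ X k U hU z]
    congr 1
    rw [← ModuleCat.comp_apply, ← singularCohomology.map_comp]
    rfl
  · rintro ⟨y, hy⟩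
    -- `y` is the germ of a section `yU` over some open `U ∋ η`
    obtain ⟨U, hU, yU, rfl⟩ := (bettiZariskiTopPresheaf ℤ X k).exists_germ_eq y
    have h' : germToFunctionField ℤ X k U hU (m • yU) =
        germToFunctionField ℤ X k ⊤ trivial (restrictToOpen ℤ X k ⊤ z) := by
      rw [map_nsmul]
      exact hy
    -- equal germs agree on a smaller open `W ∋ η`
    obtain ⟨W, hW, iU, iV, e⟩ :=
      TopCat.Presheaf.germ_eq (bettiZariskiTopPresheaf ℤ X k) (U := U) (V := ⊤) (genericPoint X.left)
        hU trivial _ _ h'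
    refine ⟨(W : Set X.left)ᶜ, W.isOpen.isClosed_compl, ?_,
      (bettiZariskiPresheaf ℤ X k).map iU.op yU, ?_⟩
    · intro h
      have hη : genericPoint X.left ∈ (W : Set X.left)ᶜ := h ▸ Set.mem_univ _
      exact hη hW
    · have e' : (bettiZariskiPresheaf ℤ X k).map iU.op (m • yU) =
          (bettiZariskiPresheaf ℤ X k).map iV.op (restrictToOpen ℤ X k ⊤ z) := e
      rw [map_nsmul, map_restrictToOpen_apply] at e'
      exact e'

end Summit.HodgeConjecture.HodgeConjecture.Theorems

end
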